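import Summits.QuantumFields.YangMills.Theorems.BalabanUVNodesN15TwoSpacingGluingNeumannKnitNodeClosed
import Summits.QuantumFields.YangMills.Theorems.BalabanUVNodesN15SizedKnitSocket
import HarnessLib

/-!
# Route «BalabanUVNodes» (K3⁸ `SpineGivenEndpointR13SepCoPHV`, stmt-QuantumFields-27366), node N15 = NE2, -a lane: `N15At` AND THE GUARD FOR dag-n15-c's GLUED KNIT FAMILY —
# ONE application of the sized knit socket (S-D `n15At_opGeoS_of_ne2PlusOperator`, `live_opGeoS`) to FILE 101's `ne2PlusOperator_knit` (the cover's glued `U ≡ 1` pair on the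
# doubled-cube tori, size `(gf i).M = L^m` LIVE, no displayed row): all three NE2 layers + dag-n15-w2's `Live`, hypothesis-free; the `NE2Objects₁₁` literal and the keyed-home face

Cell `pub-ymgap`, seat `pub-ymgap-dag-n15-a` (KNIT-BY-NAME, g23; HUMAN RULING D-0062; chair R424 venue; `bears_on: R4∕N15`).  Filed `--kind proof --supports stmt-QuantumFields-27366
--as helper` — COUNT-NEUTRAL.  Imports BY NAME dag-n15-c FILE 101 `…TwoSpacingGluingNeumannKnitNodeClosed` (★★★ `ne2PlusOperator_knit`; FILE 93 `KnitIdx`, `knitInstance`, `knitFamily`,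
`knitInstance_gf_M`) and S-D `…N15SizedKnitSocket` (`n15At_opGeoS_of_ne2PlusOperator`, `live_opGeoS`, `s_N15_of_admits_opGeoS_of_ne2PlusOperator`, `siteOnS`, `covOnS`; through it w2's
`PairedFamilyGuard.Live`, RR-1's `NE2Objects₁₁`, part 30's keyed home); nothing in the tree is modified.

WHAT.  dag-n15-c's HANDOFF §g14 item (S) «`N15At` (all three conjuncts) for the knit family: site∕unit kernels = the genuine torus objects re-indexed to `KnitIdx` (A = 0 content; plumbing)».
The knit family's coarse carrier IS the socket's `opGeo (geoS …) X blk` at `ι i = ⟨i.m + 1, i.kk, _, i.r⟩`, `Mc i = L^{i.m}` (`rfl`), so: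
* §1 `knitIota`, `knitInstance_eq_opGeoS` (`rfl`), ★★★ `n15At_gluedKnit` — `N15At ⟨KnitIdx d L, c₃₅, p, knitInstance, knitFamily a, siteOnS a_S …, covOnS α β …, ⊤, dist⟩` OUTRIGHT
  (`d ≥ 1`, odd `L ≥ 3`, `a, a_S > 0`; every `c₃₅ θc θ p`): OPERATOR = FILE 101 (glued pair, `M` live), SITE = G1's genuine `(Q′G′²Q′*)⁻¹` kernel, UNIT = [B6] (2.156) `C^{(k)}_Λ` — both
  `U ≡ 1` kernels re-based on the knit's coefficient carrier (their «+» idle, said);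
* §2 `reg_zero_knitInstance` (the trivial coefficient field is (3.35)∕(3.36)-regular at every `α₀ > 0`, `c₃₅, θ ≥ 0`), `cofinal_knitIdx` (size `L^m` AND scale count `k` jointly cofinal —
  FILE 93 `knitInstance_gf_M_unbounded` sharpened), ★★ `live_gluedKnit`, ★★★ `live_and_n15At_gluedKnit` (the pair the K3⁸ v6 guard + rates holder read);
* §3 def `gluedKnitObjects` (the family as RR-1's `NE2Objects₁₁` literal), `ne2OfRecord₁₁_gluedKnitObjects` (`rfl`), `n15At_gluedKnitObjects`, `live_gluedKnitObjects`, ★★ `s_N15_of_admits_gluedKnit` (part 30's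
  stage-generic keyed home: any reading pinned to the literal has `S_N15`).

HONEST FRAMING ∕ LIMITS.  By-name composition; no estimate proved here.  The operator layer is dag-n15-c's COMPOSITION CERTIFICATE of [B6] §2's machine at two spacings for Bałaban's `U ≡ 1`
Landau-gauge `Δ_a` on the doubled-cube tori (by FILE 70 (iii) the glued operator IS `Δ_a⁻¹`: not new information about `G`); the (3.35) window is consumed vacuously (entries independent of
the fine configuration); site∕unit layers are the `U ≡ 1` kernels (U-blind); the size `M = L^m` is live FORMALLY (ref-B CAUTION-P).  NOT [B9]'s background-dependent pair; NE2⁺ NOT PRINTED ∕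
NOT proved; N15 NOT discharged; K3⁸ OPEN, skeleton v6 untouched (its pin stays `N15PinnedSized`); counts of record UNMOVED (typed 28∕28 · discharged 5∕27); one finite 𝕋⁴ at fixed ε per
index — NOT infinite volume, NOT OS on ℝ⁴, NOT a mass gap, NOT Clay; R4 closes the conditional finite-𝕋⁴ rung `BalabanLadder.UV` only.  One plumbing `def` (§3 literal) ⇒ review lane.
-/

noncomputable section

namespace Summit.QuantumFields.YangMills.BalabanUVNodes.N15.GenuineRecord

open Literature.MathematicalPhysics.QuantumFieldTheory.Balaban1983to89
open Literature.MathematicalPhysics.QuantumFieldTheory.Balaban1983to89.T4Continuum (T4Family ULoop)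
open Literature.MathematicalPhysics.QuantumFieldTheory.Balaban1983to89.T4EtaRate (EtaPairing PairedInstance NE2PlusOperator NE2PlusSite NE2PlusUnit)
open Literature.MathematicalPhysics.QuantumFieldTheory.Balaban1983to89.B5Prop11Plancherel (Tor fine)
open Literature.MathematicalPhysics.QuantumFieldTheory.Balaban1983to89.T4EtaRateCoeffDefect (FibreOsc)
open Node00 (NE2Objects₁₁)
open Summit.QuantumFields.YangMills.BalabanUVNodes.N15.OperatorReadout (opGeo)
open Summit.QuantumFields.YangMills.BalabanUVNodes.N15.TwoGrid (TGIndex)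
open Summit.QuantumFields.YangMills.BalabanUVNodes.N15.BackgroundLayer (coeffBg fineGeo bgPairing bgInstance reg335_coeffBg_iff)
open Summit.QuantumFields.YangMills.BalabanUVNodes.N15.Gluing (KnitIdx knitTor knitGeo KnitX KnitX' knitBlk knitPr knitInstance knitFamily knitGeo_L_ne_zero ne2PlusOperator_knit)
open Summit.QuantumFields.YangMills.BalabanUVNodes.N15.AtKeyedHome (s_N15_of_admits)
open Summit.QuantumFields.YangMills.BalabanUVNodes.N15.PairedFamilyGuard (Live)
open YMDAG.UVSplit (Datum NE2Carriers RateCarriers RateRecordPred N15At S_N15 ne2OfRecord₁₁)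

variable {d : ℕ} {L : ℕ} [NeZero L]

/-! ## §1 The knit family is an instance of the sized socket; `N15At` outright -/

/-- the knit index read as a torus index of this lane: doubled torus exponent `m + 1`, coarse level `kk`, refinement `r`. [bookkeeping] -/
def knitIota (i : KnitIdx d L) : TGIndex := ⟨i.m + 1, i.kk, i.one_le, i.r⟩

omit [NeZero L] in
/-- `m_T = m + 1 ≥ 1` on the knit index. [folklore] -/
theorem one_le_knitIota_mT (i : KnitIdx d L) : 1 ≤ (knitIota i).mT := Nat.succ_pos _

/-- THE KNIT INSTANCE IS THE SOCKET's LITERAL at `ι = knitIota`, `Mc i = L^m` (`rfl`). [bookkeeping] -/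
theorem knitInstance_eq_opGeoS (hL : Odd L ∧ 1 < L) (θc θ : ℝ) :
    knitInstance (d := d) hL θc θ = fun i =>
      (⟨opGeo (geoS d hL knitIota (fun i => (L : ℝ) ^ i.m) i) (KnitX hL i) (knitBlk hL i), (knitInstance hL θc θ i).gf, (knitInstance hL θc θ i).Bc,
        (knitInstance hL θc θ i).Bf, (knitInstance hL θc θ i).pair⟩ : PairedInstance) := rfl

/-- ★★★ **`N15At` FOR dag-n15-c's GLUED KNIT FAMILY, OUTRIGHT** (`d ≥ 1`, odd `L ≥ 3`, `a, a_S > 0`; every `c₃₅ θc θ p`, directions `α β`): OPERATOR = FILE 101 `ne2PlusOperator_knit` (the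
cover's glued `U ≡ 1` pair, size `L^m` live), SITE = G1's genuine `(Q′G′²Q′*)⁻¹` kernel, UNIT = [B6] (2.156) `C^{(k)}_Λ`, through the sized socket S-D. [bookkeeping] -/
theorem n15At_gluedKnit (hd : 1 ≤ d) (hLodd : Odd L) (hL2 : 2 ≤ L) (hL : Odd L ∧ 1 < L) {a aS : ℝ} (ha : 0 < a) (haS : 0 < aS) (α β : Fin (d + 1)) (c35 θc θ p : ℝ) :
    N15At { I := KnitIdx d L, c35 := c35, p := p, pi := knitInstance hL θc θ, Kop := knitFamily hL a θc θ,
            Ksite := siteOnS d hL aS knitIota (fun i => (L : ℝ) ^ i.m) (fun i => KnitX hL i) (fun i => knitBlk hL i) (fun i => (knitInstance hL θc θ i).Bf),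
            Kunit := covOnS d hL α β knitIota (fun i => (L : ℝ) ^ i.m) (fun i => KnitX hL i) (fun i => knitBlk hL i) (fun i => (knitInstance hL θc θ i).Bf),
            inΛ := fun _ _ => True, unitDist := fun i => (knitInstance hL θc θ i).gc.dist } :=
  n15At_opGeoS_of_ne2PlusOperator (d := d) hL knitIota (fun i => (L : ℝ) ^ i.m) (fun i => KnitX hL i) (fun i => knitBlk hL i)
    (fun i => (knitInstance hL θc θ i).gf) (fun i => (knitInstance hL θc θ i).Bc) (fun i => (knitInstance hL θc θ i).Bf)
    hd hLodd hL2 haS α β one_le_knitIota_mT (fun i => (knitInstance hL θc θ i).pair) p (knitFamily hL a θc θ) (ne2PlusOperator_knit hd hL ha c35 θc θ)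

/-! ## §2 The family passes the guard; guard ∧ estimate together -/

/-- the trivial coefficient field of the knit's fine carrier is (3.35)∕(3.36)-regular at every `α₀ > 0` (`c₃₅, θ ≥ 0`). [folklore] -/
theorem reg_zero_knitInstance (hL : Odd L ∧ 1 < L) {c35 θ : ℝ} (hc35 : 0 ≤ c35) (hθ : 0 ≤ θ) (θc : ℝ) (i : KnitIdx d L) {α₀ : ℝ} (hα₀ : 0 < α₀) :
    (knitInstance hL θc θ i).Bf.Reg335 c35 α₀ (knitInstance hL θc θ i).Bf.one ∧ (knitInstance hL θc θ i).Bf.Reg336 c35 α₀ (knitInstance hL θc θ i).Bf.one := by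
  have hM : 0 ≤ (knitGeo hL i).M := by show 0 ≤ (L : ℝ) ^ i.m; positivity
  have h1 : ∀ x' : KnitX' hL i, |(0 : KnitX' hL i → ℝ) x'| ≤ c35 * (knitGeo hL i).M * α₀ := fun x' => by
    rw [Pi.zero_apply, abs_zero]; exact mul_nonneg (mul_nonneg hc35 hM) hα₀.le
  have h2 : FibreOsc (knitPr hL i) (0 : KnitX' hL i → ℝ) (fun _ => c35 * (knitGeo hL i).M * α₀ * θ) := fun x₁ x₂ _ => by
    rw [Pi.zero_apply, Pi.zero_apply, sub_zero, abs_zero]; exact mul_nonneg (mul_nonneg (mul_nonneg hc35 hM) hα₀.le) hθ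
  exact ⟨⟨h1, h2⟩, ⟨h1, h2⟩⟩

omit [NeZero L] in
/-- size `L^m` and scale count `kk` are JOINTLY cofinal on the knit index (`L ≥ 2`). [folklore] -/
theorem cofinal_knitIdx (hL2 : 2 ≤ L) (μ ν : Fin (d + 1)) (M₅ : ℝ) (k₀ : ℕ) : ∃ i : KnitIdx d L, M₅ ≤ (L : ℝ) ^ i.m ∧ k₀ ≤ (knitIota i).k := by
  have hL1 : (1 : ℝ) < L := by exact_mod_cast (show 1 < L by omega)
  obtain ⟨m, hm⟩ := pow_unbounded_of_one_lt M₅ hL1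
  have h4 : 4 ≤ L ^ max k₀ 2 :=
    calc 4 = 2 ^ 2 := by norm_num
      _ ≤ L ^ 2 := Nat.pow_le_pow_left hL2 2
      _ ≤ L ^ max k₀ 2 := Nat.pow_le_pow_right (by omega) (le_max_right _ _)
  exact ⟨⟨m, max k₀ 2, 0, le_trans (by norm_num) (le_max_right _ _), h4, μ, ν⟩, hm.le, le_max_left _ _⟩

/-- ★★ **THE KNIT FAMILY PASSES THE K3⁷∕K3⁸ GUARD** (dag-n15-w2's `Live` BY NAME) for ANY kernels: size and scale count jointly cofinal, the trivial field regular, the region `⊤` met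
(`c₃₅, θ ≥ 0`, `L ≥ 2`, `d + 1 ≥ 1` directions). [bookkeeping] -/
theorem live_gluedKnit (hL2 : 2 ≤ L) (hL : Odd L ∧ 1 < L) {c35 θ : ℝ} (hc35 : 0 ≤ c35) (hθ : 0 ≤ θ) (θc p : ℝ)
    (Kop : ∀ i, B9.KernelFamily (knitInstance (d := d) hL θc θ i).gc (knitInstance hL θc θ i).Bf)
    (Ksite Kunit : ∀ i, B9.SiteKernel (knitInstance (d := d) hL θc θ i).gc (knitInstance hL θc θ i).Bf) :
    Live ⟨KnitIdx d L, c35, p, knitInstance hL θc θ, Kop, Ksite, Kunit, fun _ _ => True, fun i => (knitInstance hL θc θ i).gc.dist⟩ :=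
  live_opGeoS (d := d) hL knitIota (fun i => (L : ℝ) ^ i.m) (fun i => KnitX hL i) (fun i => knitBlk hL i)
    (fun i => (knitInstance hL θc θ i).gf) (fun i => (knitInstance hL θc θ i).Bc) (fun i => (knitInstance hL θc θ i).Bf)
    (fun i => (knitInstance hL θc θ i).pair) c35 p Kop Ksite Kunit (cofinal_knitIdx hL2 0 0) (fun i _ hα₀ => reg_zero_knitInstance hL hc35 hθ θc i hα₀)

/-- ★★★ **GUARD ∧ `N15At` FOR THE GLUED KNIT FAMILY** (`d ≥ 1`, odd `L ≥ 3`, `a, a_S > 0`, `c₃₅, θ ≥ 0`). [bookkeeping] -/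
theorem live_and_n15At_gluedKnit (hd : 1 ≤ d) (hLodd : Odd L) (hL2 : 2 ≤ L) (hL : Odd L ∧ 1 < L) {a aS c35 θ : ℝ} (ha : 0 < a) (haS : 0 < aS) (hc35 : 0 ≤ c35) (hθ : 0 ≤ θ)
    (α β : Fin (d + 1)) (θc p : ℝ) :
    Live ⟨KnitIdx d L, c35, p, knitInstance hL θc θ, knitFamily hL a θc θ,
        siteOnS d hL aS knitIota (fun i => (L : ℝ) ^ i.m) (fun i => KnitX hL i) (fun i => knitBlk hL i) (fun i => (knitInstance hL θc θ i).Bf),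
        covOnS d hL α β knitIota (fun i => (L : ℝ) ^ i.m) (fun i => KnitX hL i) (fun i => knitBlk hL i) (fun i => (knitInstance hL θc θ i).Bf), fun _ _ => True,
        fun i => (knitInstance hL θc θ i).gc.dist⟩ ∧
      N15At { I := KnitIdx d L, c35 := c35, p := p, pi := knitInstance hL θc θ, Kop := knitFamily hL a θc θ,
              Ksite := siteOnS d hL aS knitIota (fun i => (L : ℝ) ^ i.m) (fun i => KnitX hL i) (fun i => knitBlk hL i) (fun i => (knitInstance hL θc θ i).Bf),
              Kunit := covOnS d hL α β knitIota (fun i => (L : ℝ) ^ i.m) (fun i => KnitX hL i) (fun i => knitBlk hL i) (fun i => (knitInstance hL θc θ i).Bf),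
              inΛ := fun _ _ => True, unitDist := fun i => (knitInstance hL θc θ i).gc.dist } :=
  ⟨live_gluedKnit hL2 hL hc35 hθ θc p _ _ _, n15At_gluedKnit hd hLodd hL2 hL ha haS α β c35 θc θ p⟩

/-! ## §3 The family as an `NE2Objects₁₁` literal; the keyed-home face -/

/-- THE GLUED KNIT FAMILY AS RR-1's NE2 OBJECT LITERAL (`NE2Objects₁₁`), field for field. [bookkeeping] -/
def gluedKnitObjects (d : ℕ) (hL : Odd L ∧ 1 < L) (a aS : ℝ) (α β : Fin (d + 1)) (c35 θc θ p : ℝ) : NE2Objects₁₁ :=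
  ⟨KnitIdx d L, c35, p, knitInstance hL θc θ, knitFamily hL a θc θ,
    siteOnS d hL aS knitIota (fun i => (L : ℝ) ^ i.m) (fun i => KnitX hL i) (fun i => knitBlk hL i) (fun i => (knitInstance hL θc θ i).Bf),
    covOnS d hL α β knitIota (fun i => (L : ℝ) ^ i.m) (fun i => KnitX hL i) (fun i => knitBlk hL i) (fun i => (knitInstance hL θc θ i).Bf), fun _ _ => True,
    fun i => (knitInstance hL θc θ i).gc.dist⟩

/-- the record map reads the literal as the rates bundle (`rfl`). [bookkeeping] -/
theorem ne2OfRecord₁₁_gluedKnitObjects (hL : Odd L ∧ 1 < L) (a aS : ℝ) (α β : Fin (d + 1)) (c35 θc θ p : ℝ) :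
    ne2OfRecord₁₁ (gluedKnitObjects d hL a aS α β c35 θc θ p) =
      { I := KnitIdx d L, c35 := c35, p := p, pi := knitInstance hL θc θ, Kop := knitFamily hL a θc θ,
        Ksite := siteOnS d hL aS knitIota (fun i => (L : ℝ) ^ i.m) (fun i => KnitX hL i) (fun i => knitBlk hL i) (fun i => (knitInstance hL θc θ i).Bf),
        Kunit := covOnS d hL α β knitIota (fun i => (L : ℝ) ^ i.m) (fun i => KnitX hL i) (fun i => knitBlk hL i) (fun i => (knitInstance hL θc θ i).Bf),
        inΛ := fun _ _ => True, unitDist := fun i => (knitInstance hL θc θ i).gc.dist } := rfl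

/-- ★★ `N15At` at the literal. [bookkeeping] -/
theorem n15At_gluedKnitObjects (hd : 1 ≤ d) (hLodd : Odd L) (hL2 : 2 ≤ L) (hL : Odd L ∧ 1 < L) {a aS : ℝ} (ha : 0 < a) (haS : 0 < aS) (α β : Fin (d + 1)) (c35 θc θ p : ℝ) :
    N15At (ne2OfRecord₁₁ (gluedKnitObjects d hL a aS α β c35 θc θ p)) :=
  n15At_gluedKnit hd hLodd hL2 hL ha haS α β c35 θc θ p

/-- ★★ the literal is LIVE (`c₃₅, θ ≥ 0`). [bookkeeping] -/
theorem live_gluedKnitObjects (hL2 : 2 ≤ L) (hL : Odd L ∧ 1 < L) (a aS : ℝ) (α β : Fin (d + 1)) {c35 θ : ℝ} (hc35 : 0 ≤ c35) (hθ : 0 ≤ θ) (θc p : ℝ) :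
    Live (ne2OfRecord₁₁ (gluedKnitObjects d hL a aS α β c35 θc θ p)) :=
  live_gluedKnit hL2 hL hc35 hθ θc p _ _ _

variable {N : ℕ} [NeZero N] {key : (F : T4Family) → Datum F N → Prop}

/-- ★★ **THE GLUED KNIT AT ANY KEYED HOME** (part 30's interface): a rate home over ANY key admitting only the literals of a key-indexed NE2 reading whose value everywhere is the
glued knit family has `S_N15 RRec` (`d ≥ 1`, odd `L ≥ 3`, `a, a_S > 0`). [bookkeeping] -/
theorem s_N15_of_admits_gluedKnit (hd : 1 ≤ d) (hLodd : Odd L) (hL2 : 2 ≤ L) (hL : Odd L ∧ 1 < L) {a aS : ℝ} (ha : 0 < a) (haS : 0 < aS) (α β : Fin (d + 1))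
    (c35 θc θ p : ℝ) (ne2At : ∀ {F : T4Family} {D : Datum F N}, key F D → (ℕ → ℝ) → List (ULoop F) → ℕ → NE2Objects₁₁) (RRec : RateRecordPred N)
    (hadm : ∀ (F : T4Family) (D : Datum F N) (g₀ : ℕ → ℝ) (os : List (ULoop F)) (R : RateCarriers N), RRec F D g₀ os R →
      ∃ (h : key F D) (k : ℕ), R.ne2 = ne2OfRecord₁₁ (ne2At h g₀ os k))
    (h : ∀ (F : T4Family) (D : Datum F N) (h : key F D) (g₀ : ℕ → ℝ) (os : List (ULoop F)) (k : ℕ), ne2At h g₀ os k = gluedKnitObjects d hL a aS α β c35 θc θ p) :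
    S_N15 RRec :=
  s_N15_of_admits ne2At RRec hadm fun F D hk g₀ os k => by rw [h F D hk g₀ os k]; exact n15At_gluedKnitObjects hd hLodd hL2 hL ha haS α β c35 θc θ p

end Summit.QuantumFields.YangMills.BalabanUVNodes.N15.GenuineRecord

end
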